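/-
Copyright: the b2b-balaban T⁴-continuum CRUX team, row NE7b OWNER lineage `t4-ne7b-p1` (gen 121). Project licence.
-/
import Summits.QuantumFields.BalabanUV.T4Continuum.Spine.NE7b.SupTorusResponseLocality
import Summits.QuantumFields.BalabanUV.T4Continuum.Spine.NE7b.SupTorusCoshProfile

/-!
# POINTWISE EXPONENTIAL DECAY ON THE STRICTLY CONVEX CLASS: for `L_V = (n+1)²(−Δ) + V`, `V ≥ v₀ > 0` on the fine torus `(ℤ∕(n+1)s)^d`, a
# solution of `L_Vh = G` with `|G| ≤ M·e^{−δ₁ρ_s(bt ·, y₀)}` satisfies `|h x| ≤ (2M·4^d e^{2dδ}∕v₀)·e^{−δρ_s(bt x, y₀)}` at EVERY site —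
# the weighted maximum principle with (145)'s block-scale cosh profile (second-order defect `2dδ²`); hence the road's RESPONSE
# `Dt e_{y₀} = Σ_{y′}T⁻¹(y′,y₀)ψ_{y′}` obeys `|Dt e_{y₀}(x)| ≤ C·e^{−δρ_s(bt x, y₀)}` POINTWISE, `(C, δ)` from `(d, a, v₀, Λ)` only, every mesh,
# every volume — (144)'s sup bound WITH the exponential: § NEXT (3)(b) on the class `v₀ ≤ V ≤ Λ` now pointwise AND local
# (row NE7b, node U5c; (131)–(137), (145) BY NAME; [folklore])

Cell `pub-balaban`, sub-cell `t4`, spine estimate NE7b (`T4WeightBudget.RelWeightBound`; the cell's OWN estimate — NOT PRINTED in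
[Bałaban 1983–89], NOT PROVED).  Crux-route work under `Spine/NE7b/` by the row OWNER (`t4-ne7b-p1` gen 121, file (146)) under FREEZE
(0)'s crux-prover clause; NOTHING of Bałaban's is named as a Lean object, valued or asserted; no `T4Continuum/Support` leaf typed; no `def`,
no notation (`L_V` and the profile DISPLAYED; the response WRITTEN OUT, `T⁻¹` Mathlib's inverse of `Matrix.of T`); zero `sorry`.  Imports (BY
NAME): the OWNER's (145) `…SupTorusCoshProfile` (`prod_cosh_second_diff`, `prod_cosh_pos`, `cosh_sub_one_le_sq`, `cosh_sub_two_sided`,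
`antipode_nonneg`), (137) `…SupTorusResponseLocality` (`response_local`; through it (135) `nextScale_hessian_local`, (133) `weight_on_block`,
(132) `isPseudoDist_torus`, (89) TDF `siteOf_chart_surjective`, `blockOf_siteOf_of_mem`, TDFC `sum_block_comp_siteOf_eq`), Mathlib's
`Finset.exists_min_image`, `Finset.prod_le_prod`.

WHY (located).  (144): on `V ≥ v₀ > 0` the maximum principle for `L_V` makes the column pointwise, as sup BOUNDS; DECAY needs a positive
`Φ` with `L_VΦ ≥ (v₀ − θ)Φ`, `θ < v₀` mesh-free, comparable above and below with `e^{−δρ_s(bt ·, y₀)}`.  (145)'s profile `Φ(x) = Π_i cosh(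
(δ∕(n+1))·t(x i − c₀ i))` centred at the corner `c₀` of the block `y₀` is one: `(n+1)²(−ΔΦ) ≥ −2d(n+1)²(cosh(δ∕(n+1)) − 1)Φ ≥ −2dδ²Φ` (§2), and
by (145) `cosh_sub_two_sided` with (133) `weight_on_block`, `2^{−d}e^{−dδ}e^{−δρ_s}cosh^d ≤ Φ ≤ 2^de^{dδ}e^{−δρ_s}cosh^d`.  Then `K = M2^de^{dδ}∕((v₀
− 2dδ²)cosh^d)` gives `L_V(KΦ) ≥ Me^{−δρ_s} ≥ |G|` (`δ ≤ δ₁`), the comparison principle (§1: at a minimum of `w` the Laplacian term is `≤ 0`,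
so `Vw ≥ L_Vw ≥ 0`) applied to `KΦ ∓ h` gives `|h| ≤ KΦ ≤ (2M4^de^{2dδ}∕v₀)e^{−δρ_s}` (`4dδ² ≤ v₀`).  For the response, (137)'s displays give
`L_Vh_{y₀} = T⁻¹(bt ·, y₀) − a𝟙_{B_{y₀}}`, of size `(c₁ + a)e^{−δ₁ρ_s}` by (135).

WHAT IS PROVED ([folklore]; fine torus `Site d ((n+1)s)`, coarse `Site d s`, `[NeZero s]`; `L_V` DISPLAYED (no block term); `bt x = σ_s(blk n
(wm x))`; `Φ` as above; `ρ_s` = (132)'s distance written out):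
* §1 **`minPrinciple`** (`V ≥ v₀ > 0`, `L_Vw ≥ 0` pointwise ⟹ `w ≥ 0`), `lin_comb` (`L_V(Kφ + Lh) = KL_Vφ + LL_Vh`).
* §2 **`cosh_supersolution`** (`0 ≤ δ ≤ 1`, `V ≥ v₀` ⟹ `(v₀ − 2dδ²)Φ ≤ L_VΦ` pointwise), **`cosh_profile_block_bounds`** (at `x = σ(chart (wm y) z)`:
  `2^{−d}e^{−dδ}e^{−δρ_s(y,y₀)}cosh(δs∕2·…)^d ≤ Φ x ≤ 2^de^{dδ}e^{−δρ_s(y,y₀)}cosh(…)^d`).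
* §3 **`pointwise_decay`** (`V ≥ v₀ > 0`, `0 < δ ≤ min(1, δ₁)`, `4dδ² ≤ v₀`, `L_Vh = G`, `|G x| ≤ Me^{−δ₁ρ_s(bt x, y₀)}` ⟹
  `|h x| ≤ (2M4^de^{2dδ}∕v₀)·e^{−δρ_s(bt x, y₀)}` at EVERY site).
* §4 THE HEADLINE **`response_pointwise_decay`**: `∃ C δ > 0` from `(d, a, v₀, Λ)` only (`a > 0`, `v₀ > 0`, `Λ ≥ 0`) such that for ALL `n, s`,
  ALL `v₀ ≤ V ≤ Λ`, ALL block columns `ψ`, every `y₀` and EVERY fine site `x`: `|Σ_{y′}T⁻¹(y′,y₀)ψ_{y′}(x)| ≤ C·e^{−δρ_s(bt x, y₀)}`.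
* §5 toy.

HONEST (what this is NOT).  The STRICTLY CONVEX single-site class (`V ≥ v₀ > 0`) only — on the road's class `V ≥ −λ` of either sign the
pointwise theory stays open (§ NEXT (3)(b) there needs Green's-function ∕ heat-kernel bounds); the response only (the propagator `H⁻¹f` and
the covariance have sources of size `‖f‖_∞`, not decaying — their pointwise DECAY away from the source block is the same comparison once the
block-mean terms are bounded by (138)∕(139)'s profiles, not typed); `ℓ¹` circular geometry, cubic periods; constants explicit, far from sharp;
scalar skeleton ((A3), NC-NE7b-α UNRULED); nothing of Bałaban's.  BY-NAME EFFECT ON THE WALL: NONE.  NE7b NOT PRINTED ∕ NOT PROVED; spine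
PROVED 0∕9; rung (B)+1 on a FINITE torus — NOT infinite volume, NOT the mass gap, NOT Clay.  HONEST DEPENDENCY: continuum YM on T⁴ ⇐
BetaPertH ∧ nine spine estimates (0∕9 proved); BetaPertH ⇐ (D1) ∧ (D4) ∧ CAP+tail; G-an2-4 gates asym, D1 and NE2∕3∕4.
-/

set_option autoImplicit false

noncomputable section

namespace Summit.QuantumFields.BalabanUV.T4Continuum.NE7b.SupTorusComparisonDecay

open Real
open Literature.MathematicalPhysics.QuantumFieldTheory.Balaban1983to89
open B6QGQLower276 (X e blk B side chart mem_B sum_B sum_B_const card_cube blk_chart)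
open Beta (Site siteOf windowMap siteOf_windowMap siteOf_add)
open SupTorusDirichletForm (siteOf_chart_surjective blockOf_siteOf_of_mem)
open SupTorusActionForm (weight_on_block)
open SupTorusCoarseFloor (nextScale_hessian_local)
open SupTorusDirichletFormCoercive (sum_block_comp_siteOf_eq)
open SupTorusResponseLocality (response_local)
open SupTorusCoshProfile (prod_cosh_second_diff prod_cosh_pos cosh_sub_one_le_sq cosh_sub_two_sided antipode_nonneg natAbs_cast_eq_abs)

variable {d : ℕ}

/-! ## §1. The comparison principle for `L_V = (n+1)²(−Δ) + V`, `V > 0` -/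

section Comparison

variable (n s : ℕ) [NeZero s]

/-- **THE COMPARISON (MINIMUM) PRINCIPLE**: if `V ≥ v₀ > 0` and `(n+1)²Σ_μ(2w x − w(x+ê_μ) − w(x−ê_μ)) + V x·w x ≥ 0` at every site, then
`w ≥ 0` everywhere — at a minimum of `w` the Laplacian term is `≤ 0`, so `V·w ≥ 0` there. [folklore] -/
theorem minPrinciple {v₀ : ℝ} (hv₀ : 0 < v₀) (V w : Site d ((n + 1) * s) → ℝ) (hV : ∀ x, v₀ ≤ V x)
    (hw : ∀ x, 0 ≤ ((n : ℝ) + 1) ^ 2 * ∑ μ, (2 * w x - w (x + siteOf d ((n + 1) * s) (e μ)) - w (x - siteOf d ((n + 1) * s) (e μ)))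
      + V x * w x) (x : Site d ((n + 1) * s)) :
    0 ≤ w x := by
  classical
  obtain ⟨xm, -, hxm⟩ := Finset.exists_min_image Finset.univ w ⟨x, Finset.mem_univ x⟩
  have hlapm : ∑ μ : Fin d, (2 * w xm - w (xm + siteOf d ((n + 1) * s) (e μ)) - w (xm - siteOf d ((n + 1) * s) (e μ))) ≤ 0 := by
    refine Finset.sum_nonpos fun μ _ => ?_
    have h1 := hxm (xm + siteOf d ((n + 1) * s) (e μ)) (Finset.mem_univ _)
    have h2 := hxm (xm - siteOf d ((n + 1) * s) (e μ)) (Finset.mem_univ _)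
    linarith
  have hsq : (0 : ℝ) ≤ ((n : ℝ) + 1) ^ 2 := by positivity
  have h0 : 0 ≤ w xm := by
    by_contra hneg
    push Not at hneg
    have h1 := hw xm
    have h2 : V xm * w xm ≤ v₀ * w xm := mul_le_mul_of_nonpos_right (hV xm) hneg.le
    nlinarith [mul_nonpos_iff.2 (Or.inl ⟨hsq, hlapm⟩)]
  exact h0.trans (hxm x (Finset.mem_univ x))

omit [NeZero s] in
/-- The displayed `L_V` is linear: `L_V(Kφ + Lh) = K·L_Vφ + L·L_Vh` pointwise. [folklore] -/
theorem lin_comb [NeZero s] (V φ h : Site d ((n + 1) * s) → ℝ) (K L : ℝ) (x : Site d ((n + 1) * s)) :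
    ((n : ℝ) + 1) ^ 2 * ∑ μ, (2 * (K * φ x + L * h x) - (K * φ (x + siteOf d ((n + 1) * s) (e μ)) + L * h (x + siteOf d ((n + 1) * s) (e μ)))
        - (K * φ (x - siteOf d ((n + 1) * s) (e μ)) + L * h (x - siteOf d ((n + 1) * s) (e μ)))) + V x * (K * φ x + L * h x)
      = K * (((n : ℝ) + 1) ^ 2 * ∑ μ, (2 * φ x - φ (x + siteOf d ((n + 1) * s) (e μ)) - φ (x - siteOf d ((n + 1) * s) (e μ))) + V x * φ x)
        + L * (((n : ℝ) + 1) ^ 2 * ∑ μ, (2 * h x - h (x + siteOf d ((n + 1) * s) (e μ)) - h (x - siteOf d ((n + 1) * s) (e μ))) + V x * h x) := by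
  have hμ : ∀ μ : Fin d, (2 * (K * φ x + L * h x) - (K * φ (x + siteOf d ((n + 1) * s) (e μ)) + L * h (x + siteOf d ((n + 1) * s) (e μ)))
      - (K * φ (x - siteOf d ((n + 1) * s) (e μ)) + L * h (x - siteOf d ((n + 1) * s) (e μ))))
      = K * (2 * φ x - φ (x + siteOf d ((n + 1) * s) (e μ)) - φ (x - siteOf d ((n + 1) * s) (e μ)))
        + L * (2 * h x - h (x + siteOf d ((n + 1) * s) (e μ)) - h (x - siteOf d ((n + 1) * s) (e μ))) := fun μ => by ring
  rw [Finset.sum_congr rfl fun μ _ => hμ μ, Finset.sum_add_distrib, ← Finset.mul_sum, ← Finset.mul_sum]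
  ring

end Comparison

/-! ## §2. The cosh profile at the block scale is a supersolution of `L_V − (v₀ − 2dδ²)` -/

section Supersolution

variable (n s : ℕ) [NeZero s]

/-- **THE BLOCK-SCALE COSH PROFILE IS A SUPERSOLUTION**: for `Φ(x) = Π_i cosh((δ∕(n+1))·t(x i − c i))` on the fine torus `(ℤ∕(n+1)s)^d`,
`0 ≤ δ ≤ 1` and `V ≥ v₀`: `(v₀ − 2dδ²)·Φ x ≤ (n+1)²Σ_μ(2Φ x − Φ(x+ê_μ) − Φ(x−ê_μ)) + V x·Φ x` — (145) `prod_cosh_second_diff` with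
`(n+1)²(cosh(δ∕(n+1)) − 1) ≤ δ²`: the rate is at the BLOCK scale and the defect is SECOND ORDER, mesh-free. [folklore] -/
theorem cosh_supersolution {δ v₀ : ℝ} (hδ0 : 0 ≤ δ) (hδ1 : δ ≤ 1) (V : Site d ((n + 1) * s) → ℝ) (hV : ∀ x, v₀ ≤ V x)
    (c x : Site d ((n + 1) * s)) :
    (v₀ - 2 * d * δ ^ 2) * ∏ i, Real.cosh (δ / ((n : ℝ) + 1) * ((((n + 1) * s : ℕ) : ℝ) / 2 - (((x i - c i).valMinAbs.natAbs : ℕ) : ℝ)))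
      ≤ ((n : ℝ) + 1) ^ 2 * ∑ μ, (2 * ∏ i, Real.cosh (δ / ((n : ℝ) + 1) * ((((n + 1) * s : ℕ) : ℝ) / 2 - (((x i - c i).valMinAbs.natAbs : ℕ) : ℝ)))
          - ∏ i, Real.cosh (δ / ((n : ℝ) + 1) * ((((n + 1) * s : ℕ) : ℝ) / 2
              - ((((x + siteOf d ((n + 1) * s) (e μ)) i - c i).valMinAbs.natAbs : ℕ) : ℝ)))
          - ∏ i, Real.cosh (δ / ((n : ℝ) + 1) * ((((n + 1) * s : ℕ) : ℝ) / 2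
              - ((((x - siteOf d ((n + 1) * s) (e μ)) i - c i).valMinAbs.natAbs : ℕ) : ℝ))))
        + V x * ∏ i, Real.cosh (δ / ((n : ℝ) + 1) * ((((n + 1) * s : ℕ) : ℝ) / 2 - (((x i - c i).valMinAbs.natAbs : ℕ) : ℝ))) := by
  have hn : (0 : ℝ) < (n : ℝ) + 1 := by positivity
  have hP := prod_cosh_pos ((n + 1) * s) (δ / ((n : ℝ) + 1)) c x
  have hsd := prod_cosh_second_diff ((n + 1) * s) (δ / ((n : ℝ) + 1)) c x
  have hα : |δ / ((n : ℝ) + 1)| ≤ 1 := by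
    rw [abs_of_nonneg (by positivity), div_le_one hn]; linarith
  have hc := cosh_sub_one_le_sq hα
  have hd : (0 : ℝ) ≤ d := Nat.cast_nonneg d
  -- `(n+1)²·2d(cosh α − 1) ≤ 2dδ²`
  have hkey : ((n : ℝ) + 1) ^ 2 * (2 * d * (Real.cosh (δ / ((n : ℝ) + 1)) - 1)) ≤ 2 * d * δ ^ 2 := by
    have h1 : ((n : ℝ) + 1) ^ 2 * (δ / ((n : ℝ) + 1)) ^ 2 = δ ^ 2 := by field_simp
    nlinarith [mul_le_mul_of_nonneg_left hc (by positivity : (0 : ℝ) ≤ ((n : ℝ) + 1) ^ 2 * (2 * d))]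
  have h2 := mul_le_mul_of_nonneg_left hsd (le_of_lt (by positivity : (0 : ℝ) < ((n : ℝ) + 1) ^ 2))
  have h3 : v₀ * ∏ i, Real.cosh (δ / ((n : ℝ) + 1) * ((((n + 1) * s : ℕ) : ℝ) / 2 - (((x i - c i).valMinAbs.natAbs : ℕ) : ℝ)))
      ≤ V x * ∏ i, Real.cosh (δ / ((n : ℝ) + 1) * ((((n + 1) * s : ℕ) : ℝ) / 2 - (((x i - c i).valMinAbs.natAbs : ℕ) : ℝ))) :=
    mul_le_mul_of_nonneg_right (hV x) hP.le
  nlinarith [mul_le_mul_of_nonneg_right hkey hP.le]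

/-- **THE PROFILE AGAINST THE BLOCK DISTANCE**: centred at the corner `c₀ = σ(chart n (wm y₀) 0)` of the block `y₀` and read at
`x = σ(chart n (wm y) z)`: `2^{−d}e^{−dδ}e^{−δρ_s(y,y₀)}·cosh(δs∕2)^d ≤ Φ x ≤ 2^d e^{dδ}e^{−δρ_s(y,y₀)}·cosh(δs∕2)^d` (`δ ≥ 0`) — (145)
`cosh_sub_two_sided` coordinatewise and (133) `weight_on_block`. [folklore] -/
theorem cosh_profile_block_bounds {δ : ℝ} (hδ0 : 0 ≤ δ) (y₀ y : Site d s) (z : Fin d → Fin (n + 1)) :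
    (1 / 2 : ℝ) ^ d * Real.exp (-(d * δ)) * Real.exp (-(δ * ∑ i, (((y i - y₀ i).valMinAbs.natAbs : ℕ) : ℝ)))
        * Real.cosh (δ / ((n : ℝ) + 1) * ((((n + 1) * s : ℕ) : ℝ) / 2)) ^ d
      ≤ ∏ i, Real.cosh (δ / ((n : ℝ) + 1) * ((((n + 1) * s : ℕ) : ℝ) / 2
          - ((((siteOf d ((n + 1) * s) (chart n (windowMap d s y) z)) i
            - (siteOf d ((n + 1) * s) (chart n (windowMap d s y₀) 0)) i).valMinAbs.natAbs : ℕ) : ℝ)))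
    ∧ ∏ i, Real.cosh (δ / ((n : ℝ) + 1) * ((((n + 1) * s : ℕ) : ℝ) / 2
          - ((((siteOf d ((n + 1) * s) (chart n (windowMap d s y) z)) i
            - (siteOf d ((n + 1) * s) (chart n (windowMap d s y₀) 0)) i).valMinAbs.natAbs : ℕ) : ℝ)))
      ≤ (2 : ℝ) ^ d * Real.exp (d * δ) * Real.exp (-(δ * ∑ i, (((y i - y₀ i).valMinAbs.natAbs : ℕ) : ℝ)))
        * Real.cosh (δ / ((n : ℝ) + 1) * ((((n + 1) * s : ℕ) : ℝ) / 2)) ^ d := by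
  classical
  set α : ℝ := δ / ((n : ℝ) + 1) with hα
  have hα0 : 0 ≤ α := by positivity
  set x : Site d ((n + 1) * s) := siteOf d ((n + 1) * s) (chart n (windowMap d s y) z) with hx
  set c₀ : Site d ((n + 1) * s) := siteOf d ((n + 1) * s) (chart n (windowMap d s y₀) 0) with hc₀
  set T : ℝ := (((n + 1) * s : ℕ) : ℝ) / 2 with hT
  -- coordinatewise two-sided letters
  have hco : ∀ i : Fin d, Real.exp (-(α * (((x i - c₀ i).valMinAbs.natAbs : ℕ) : ℝ))) * Real.cosh (α * T) / 2
        ≤ Real.cosh (α * (T - (((x i - c₀ i).valMinAbs.natAbs : ℕ) : ℝ)))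
      ∧ Real.cosh (α * (T - (((x i - c₀ i).valMinAbs.natAbs : ℕ) : ℝ)))
        ≤ 2 * (Real.exp (-(α * (((x i - c₀ i).valMinAbs.natAbs : ℕ) : ℝ))) * Real.cosh (α * T)) := fun i =>
    cosh_sub_two_sided hα0 (Nat.cast_nonneg _) (by have := antipode_nonneg ((n + 1) * s) (x i - c₀ i); rw [hT]; linarith)
  -- products
  have hlo : ∏ i : Fin d, (Real.exp (-(α * (((x i - c₀ i).valMinAbs.natAbs : ℕ) : ℝ))) * Real.cosh (α * T) / 2)
      ≤ ∏ i, Real.cosh (α * (T - (((x i - c₀ i).valMinAbs.natAbs : ℕ) : ℝ))) :=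
    Finset.prod_le_prod (fun i _ => by positivity) fun i _ => (hco i).1
  have hhi : ∏ i, Real.cosh (α * (T - (((x i - c₀ i).valMinAbs.natAbs : ℕ) : ℝ)))
      ≤ ∏ i : Fin d, (2 * (Real.exp (-(α * (((x i - c₀ i).valMinAbs.natAbs : ℕ) : ℝ))) * Real.cosh (α * T))) :=
    Finset.prod_le_prod (fun i _ => (Real.cosh_pos _).le) fun i _ => (hco i).2
  -- the products of exponentials: `Π e^{−α s_i} = e^{−αρ_N(x,c₀)}`, and `αρ_N` against `δρ_s ± dδ`
  have hexp : ∏ i : Fin d, Real.exp (-(α * (((x i - c₀ i).valMinAbs.natAbs : ℕ) : ℝ)))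
      = Real.exp (-(α * ∑ i, (((x i - c₀ i).valMinAbs.natAbs : ℕ) : ℝ))) := by
    rw [← Real.exp_sum, Finset.mul_sum, Finset.sum_neg_distrib]
  have hw := weight_on_block n s y y₀ z hδ0
  simp only [← hx, ← hc₀, ← hα] at hw
  have hE1 : Real.exp (-(d * δ)) * Real.exp (-(δ * ∑ i, (((y i - y₀ i).valMinAbs.natAbs : ℕ) : ℝ)))
      ≤ Real.exp (-(α * ∑ i, (((x i - c₀ i).valMinAbs.natAbs : ℕ) : ℝ))) := by
    rw [← Real.exp_add]; exact Real.exp_le_exp.2 (by linarith [hw.2])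
  have hE2 : Real.exp (-(α * ∑ i, (((x i - c₀ i).valMinAbs.natAbs : ℕ) : ℝ)))
      ≤ Real.exp (d * δ) * Real.exp (-(δ * ∑ i, (((y i - y₀ i).valMinAbs.natAbs : ℕ) : ℝ))) := by
    rw [← Real.exp_add]; exact Real.exp_le_exp.2 (by linarith [hw.1])
  have hC0 : 0 ≤ Real.cosh (α * T) ^ d := pow_nonneg (Real.cosh_pos _).le d
  constructor
  · refine le_trans ?_ hlo
    rw [Finset.prod_div_distrib, Finset.prod_mul_distrib, hexp, Finset.prod_const, Finset.prod_const, Finset.card_univ, Fintype.card_fin]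
    rw [show ((1 : ℝ) / 2) ^ d * Real.exp (-(d * δ)) * Real.exp (-(δ * ∑ i, (((y i - y₀ i).valMinAbs.natAbs : ℕ) : ℝ))) * Real.cosh (α * T) ^ d
        = (Real.exp (-(d * δ)) * Real.exp (-(δ * ∑ i, (((y i - y₀ i).valMinAbs.natAbs : ℕ) : ℝ)))) * Real.cosh (α * T) ^ d / (2 : ℝ) ^ d by
      rw [one_div_pow]; ring]
    exact div_le_div_of_nonneg_right (mul_le_mul_of_nonneg_right hE1 hC0) (by positivity)
  · refine hhi.trans ?_
    rw [Finset.prod_mul_distrib, Finset.prod_mul_distrib, hexp, Finset.prod_const, Finset.prod_const, Finset.card_univ, Fintype.card_fin]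
    calc (2 : ℝ) ^ d * (Real.exp (-(α * ∑ i, (((x i - c₀ i).valMinAbs.natAbs : ℕ) : ℝ))) * Real.cosh (α * T) ^ d)
        ≤ (2 : ℝ) ^ d * ((Real.exp (d * δ) * Real.exp (-(δ * ∑ i, (((y i - y₀ i).valMinAbs.natAbs : ℕ) : ℝ)))) * Real.cosh (α * T) ^ d) :=
          mul_le_mul_of_nonneg_left (mul_le_mul_of_nonneg_right hE2 hC0) (by positivity)
      _ = _ := by ring

end Supersolution

/-! ## §3. A solution of `L_Vh = G` with a source decaying from a block decays POINTWISE at the block scale -/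

section Decay

variable (n s : ℕ) [NeZero s] {v₀ δ δ₁ M : ℝ} (hv₀ : 0 < v₀) (hδ0 : 0 < δ) (hδ1 : δ ≤ 1) (hδδ₁ : δ ≤ δ₁) (hgap : 4 * d * δ ^ 2 ≤ v₀)
  (V : Site d ((n + 1) * s) → ℝ) (hV : ∀ x, v₀ ≤ V x) (y₀ : Site d s) (h G : Site d ((n + 1) * s) → ℝ)
  (hG : ∀ x, |G x| ≤ M * Real.exp (-(δ₁ * ∑ i, ((((siteOf d s (blk n (windowMap d ((n + 1) * s) x))) i - y₀ i).valMinAbs.natAbs : ℕ) : ℝ))))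
  (hh : ∀ x, ((n : ℝ) + 1) ^ 2 * ∑ μ, (2 * h x - h (x + siteOf d ((n + 1) * s) (e μ)) - h (x - siteOf d ((n + 1) * s) (e μ))) + V x * h x = G x)

include hv₀ hδ0 hδ1 hδδ₁ hgap hV hG hh in
/-- **POINTWISE EXPONENTIAL DECAY BY COMPARISON**: if `V ≥ v₀ > 0`, `0 < δ ≤ min(1, δ₁)`, `4dδ² ≤ v₀`, and `L_Vh = G` with
`|G x| ≤ M·e^{−δ₁ρ_s(bt x, y₀)}`, then at EVERY site `|h x| ≤ (2M·4^d·e^{2dδ}∕v₀)·e^{−δρ_s(bt x, y₀)}` — the comparison principle applied to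
`KΦ ∓ h` with the block-scale cosh profile `Φ` centred at the corner of the block `y₀`, `K` tuned so that `L_V(KΦ) ≥ |G|`. MESH-FREE,
VOLUME-FREE, POINTWISE. [folklore] -/
theorem pointwise_decay (x : Site d ((n + 1) * s)) :
    |h x| ≤ 2 * M * (4 : ℝ) ^ d * Real.exp (2 * d * δ) / v₀
      * Real.exp (-(δ * ∑ i, ((((siteOf d s (blk n (windowMap d ((n + 1) * s) x))) i - y₀ i).valMinAbs.natAbs : ℕ) : ℝ))) := by
  classical
  have hd : (0 : ℝ) ≤ d := Nat.cast_nonneg d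
  have hM : 0 ≤ M := le_of_mul_le_mul_right (by rw [zero_mul]; exact (abs_nonneg _).trans (hG x)) (Real.exp_pos _)
  have hgap' : v₀ / 2 ≤ v₀ - 2 * d * δ ^ 2 := by linarith
  have hm0 : 0 < v₀ - 2 * d * δ ^ 2 := by linarith
  set c₀ : Site d ((n + 1) * s) := siteOf d ((n + 1) * s) (chart n (windowMap d s y₀) 0) with hc₀
  set Φ : Site d ((n + 1) * s) → ℝ := fun x' => ∏ i, Real.cosh (δ / ((n : ℝ) + 1) * ((((n + 1) * s : ℕ) : ℝ) / 2
    - (((x' i - c₀ i).valMinAbs.natAbs : ℕ) : ℝ))) with hΦ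
  set Ch : ℝ := Real.cosh (δ / ((n : ℝ) + 1) * ((((n + 1) * s : ℕ) : ℝ) / 2)) ^ d with hCh
  have hCh0 : 0 < Ch := pow_pos (Real.cosh_pos _) d
  set K : ℝ := M * (2 : ℝ) ^ d * Real.exp (d * δ) / ((v₀ - 2 * d * δ ^ 2) * Ch) with hK
  have hK0 : 0 ≤ K := by positivity
  have hbounds : ∀ x' : Site d ((n + 1) * s),
      (1 / 2 : ℝ) ^ d * Real.exp (-(d * δ))
          * Real.exp (-(δ * ∑ i, ((((siteOf d s (blk n (windowMap d ((n + 1) * s) x'))) i - y₀ i).valMinAbs.natAbs : ℕ) : ℝ))) * Ch ≤ Φ x'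
        ∧ Φ x' ≤ (2 : ℝ) ^ d * Real.exp (d * δ)
          * Real.exp (-(δ * ∑ i, ((((siteOf d s (blk n (windowMap d ((n + 1) * s) x'))) i - y₀ i).valMinAbs.natAbs : ℕ) : ℝ))) * Ch := by
    intro x'
    obtain ⟨⟨y, z⟩, hyz⟩ := siteOf_chart_surjective n s x'
    simp only at hyz
    rw [← hyz, blockOf_siteOf_of_mem n s (mem_B.2 (blk_chart n (windowMap d s y) z))]
    exact cosh_profile_block_bounds n s hδ0.le y₀ y z
  have hsuper : ∀ x', |G x'| ≤ K * (((n : ℝ) + 1) ^ 2 * ∑ μ, (2 * Φ x' - Φ (x' + siteOf d ((n + 1) * s) (e μ)) - Φ (x' - siteOf d ((n + 1) * s) (e μ)))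
      + V x' * Φ x') := by
    intro x'
    have h1 := cosh_supersolution n s hδ0.le hδ1 V hV c₀ x'
    have h2 := mul_le_mul_of_nonneg_left h1 hK0
    refine le_trans ?_ h2
    have hlo := (hbounds x').1
    have hρ : 0 ≤ ∑ i, ((((siteOf d s (blk n (windowMap d ((n + 1) * s) x'))) i - y₀ i).valMinAbs.natAbs : ℕ) : ℝ) :=
      Finset.sum_nonneg fun _ _ => Nat.cast_nonneg _
    have hexp : Real.exp (-(δ₁ * ∑ i, ((((siteOf d s (blk n (windowMap d ((n + 1) * s) x'))) i - y₀ i).valMinAbs.natAbs : ℕ) : ℝ)))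
        ≤ Real.exp (-(δ * ∑ i, ((((siteOf d s (blk n (windowMap d ((n + 1) * s) x'))) i - y₀ i).valMinAbs.natAbs : ℕ) : ℝ))) :=
      Real.exp_le_exp.2 (by nlinarith [mul_le_mul_of_nonneg_right hδδ₁ hρ])
    have hKid : K * ((v₀ - 2 * d * δ ^ 2) * ((1 / 2 : ℝ) ^ d * Real.exp (-(d * δ))
        * Real.exp (-(δ * ∑ i, ((((siteOf d s (blk n (windowMap d ((n + 1) * s) x'))) i - y₀ i).valMinAbs.natAbs : ℕ) : ℝ))) * Ch))
        = M * Real.exp (-(δ * ∑ i, ((((siteOf d s (blk n (windowMap d ((n + 1) * s) x'))) i - y₀ i).valMinAbs.natAbs : ℕ) : ℝ))) := by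
      rw [hK, one_div_pow, Real.exp_neg (d * δ)]
      field_simp
      have hne' : v₀ - (d : ℝ) * δ ^ 2 * 2 ≠ 0 := (by linarith : (0 : ℝ) < v₀ - (d : ℝ) * δ ^ 2 * 2).ne'
      rw [mul_div_assoc, div_self hne', mul_one]
    calc |G x'| ≤ M * Real.exp (-(δ₁ * ∑ i, ((((siteOf d s (blk n (windowMap d ((n + 1) * s) x'))) i - y₀ i).valMinAbs.natAbs : ℕ) : ℝ))) := hG x'
      _ ≤ M * Real.exp (-(δ * ∑ i, ((((siteOf d s (blk n (windowMap d ((n + 1) * s) x'))) i - y₀ i).valMinAbs.natAbs : ℕ) : ℝ))) :=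
          mul_le_mul_of_nonneg_left hexp hM
      _ = K * ((v₀ - 2 * d * δ ^ 2) * ((1 / 2 : ℝ) ^ d * Real.exp (-(d * δ))
          * Real.exp (-(δ * ∑ i, ((((siteOf d s (blk n (windowMap d ((n + 1) * s) x'))) i - y₀ i).valMinAbs.natAbs : ℕ) : ℝ))) * Ch)) := hKid.symm
      _ ≤ K * ((v₀ - 2 * d * δ ^ 2) * Φ x') := mul_le_mul_of_nonneg_left (mul_le_mul_of_nonneg_left hlo hm0.le) hK0
  have hplus : 0 ≤ K * Φ x + (-1) * h x := by
    refine minPrinciple n s hv₀ V (fun x' => K * Φ x' + (-1) * h x') hV (fun x' => ?_) x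
    rw [lin_comb n s V Φ h K (-1) x', hh x']
    linarith [hsuper x', le_abs_self (G x')]
  have hminus : 0 ≤ K * Φ x + 1 * h x := by
    refine minPrinciple n s hv₀ V (fun x' => K * Φ x' + 1 * h x') hV (fun x' => ?_) x
    rw [lin_comb n s V Φ h K 1 x', hh x']
    linarith [hsuper x', neg_abs_le (G x')]
  have habs : |h x| ≤ K * Φ x := abs_le.2 ⟨by linarith, by linarith⟩
  refine habs.trans ?_
  have hhi := (hbounds x).2
  have hE0 : 0 ≤ Real.exp (-(δ * ∑ i, ((((siteOf d s (blk n (windowMap d ((n + 1) * s) x))) i - y₀ i).valMinAbs.natAbs : ℕ) : ℝ))) :=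
    (Real.exp_pos _).le
  calc K * Φ x ≤ K * ((2 : ℝ) ^ d * Real.exp (d * δ)
        * Real.exp (-(δ * ∑ i, ((((siteOf d s (blk n (windowMap d ((n + 1) * s) x))) i - y₀ i).valMinAbs.natAbs : ℕ) : ℝ))) * Ch) :=
        mul_le_mul_of_nonneg_left hhi hK0
    _ = (M * (4 : ℝ) ^ d * Real.exp (2 * d * δ) / (v₀ - 2 * d * δ ^ 2))
        * Real.exp (-(δ * ∑ i, ((((siteOf d s (blk n (windowMap d ((n + 1) * s) x))) i - y₀ i).valMinAbs.natAbs : ℕ) : ℝ))) := by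
        rw [hK, show (4 : ℝ) ^ d = (2 : ℝ) ^ d * (2 : ℝ) ^ d by rw [← mul_pow]; norm_num,
          show Real.exp (2 * d * δ) = Real.exp (d * δ) * Real.exp (d * δ) by rw [← Real.exp_add]; ring_nf]
        field_simp
    _ ≤ _ := by
        refine mul_le_mul_of_nonneg_right ?_ hE0
        rw [div_le_div_iff₀ hm0 hv₀]
        have : 0 ≤ M * (4 : ℝ) ^ d * Real.exp (2 * d * δ) := by positivity
        nlinarith

end Decay

/-! ## §4. THE END: on the strictly convex class the road's response decays POINTWISE, exponentially at the block scale -/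

/-- **HEADLINE — POINTWISE EXPONENTIAL DECAY OF THE RESPONSE ON THE STRICTLY CONVEX SINGLE-SITE CLASS, MESH- AND VOLUME-FREE.**  Fix
`d`, `a > 0`, `v₀ > 0`, `Λ ≥ 0`.  THERE ARE `C, δ > 0` (functions of these only) such that for ALL `n, s`, ALL `v₀ ≤ V ≤ Λ`, ALL block columns
`ψ` (`Hψ_{y′} = 𝟙[bt · = y′]`), every block `y₀` and EVERY fine site `x`: the response `h_{y₀} = Σ_{y′}T⁻¹(y′,y₀)ψ_{y′}` (`= Dt e_{y₀}`, (100)∕(136))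
satisfies `|h_{y₀}(x)| ≤ C·e^{−δρ_s(bt x, y₀)}` — `L_Vh_{y₀} = T⁻¹(bt ·, y₀) − a𝟙_{B_{y₀}}` ((137)'s displays) decays like `(c₁ + a)e^{−δ₁ρ_s}`
((135)), and §3's comparison with the block-scale cosh profile converts the decay of the SOURCE into decay of the SOLUTION, pointwise.
The `(n+1)^{d∕2}` of every earlier pointwise statement is gone, WITH the exponential. [folklore] -/
theorem response_pointwise_decay (a : ℝ) (ha : 0 < a) {v₀ Lam : ℝ} (hv₀ : 0 < v₀) (hLam : 0 ≤ Lam) :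
    ∃ C δ : ℝ, 0 < C ∧ 0 < δ ∧ ∀ (n s : ℕ) [NeZero s] (V : Site d ((n + 1) * s) → ℝ), (∀ x, v₀ ≤ V x) → (∀ x, V x ≤ Lam) →
      ∀ ψ : Site d s → Site d ((n + 1) * s) → ℝ,
      (∀ y' x, ((n : ℝ) + 1) ^ 2 * ∑ μ, (2 * ψ y' x - ψ y' (x + siteOf d ((n + 1) * s) (e μ)) - ψ y' (x - siteOf d ((n + 1) * s) (e μ)))
        + a / ((n : ℝ) + 1) ^ d * ∑ q ∈ B n (blk n (windowMap d ((n + 1) * s) x)), ψ y' (siteOf d ((n + 1) * s) q) + V x * ψ y' x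
        = if siteOf d s (blk n (windowMap d ((n + 1) * s) x)) = y' then 1 else 0) →
      ∀ (y₀ : Site d s) (x : Site d ((n + 1) * s)),
        |∑ y', (Matrix.of fun yy y'' : Site d s =>
            (((n : ℝ) + 1) ^ d)⁻¹ * ∑ z : Fin d → Fin (n + 1), ψ y'' (siteOf d ((n + 1) * s) (chart n (windowMap d s yy) z)))⁻¹ y' y₀
            * ψ y' x|
          ≤ C * Real.exp (-(δ * ∑ i, ((((siteOf d s (blk n (windowMap d ((n + 1) * s) x))) i - y₀ i).valMinAbs.natAbs : ℕ) : ℝ))) := by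
  classical
  have hd : (0 : ℝ) ≤ d := Nat.cast_nonneg d
  have hm0 : 0 < min 2 a - (-v₀) := by have : 0 ≤ min 2 a := le_min zero_le_two ha.le; linarith
  obtain ⟨c₁, δ₁, hc₁, hδ₁, H135⟩ := nextScale_hessian_local (d := d) a ha hm0 hLam
  obtain ⟨C7, δ7, -, -, H137⟩ := response_local (d := d) a ha hm0 hLam
  set δ : ℝ := min δ₁ (min 1 (v₀ / (4 * d + 4))) with hδ_def
  have hδ0 : 0 < δ := lt_min hδ₁ (lt_min one_pos (by positivity))
  have hδδ₁ : δ ≤ δ₁ := min_le_left _ _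
  have hδ1 : δ ≤ 1 := (min_le_right _ _).trans (min_le_left _ _)
  have hδv : δ ≤ v₀ / (4 * d + 4) := (min_le_right _ _).trans (min_le_right _ _)
  have hgap : 4 * d * δ ^ 2 ≤ v₀ := by
    have h1 : δ ^ 2 ≤ δ := by nlinarith
    have h2 : δ * (4 * d + 4) ≤ v₀ := by rwa [le_div_iff₀ (by positivity)] at hδv
    nlinarith
  refine ⟨2 * (c₁ + a) * (4 : ℝ) ^ d * Real.exp (2 * d) / v₀, δ, by positivity, hδ0, ?_⟩
  intro n s _ V hV hV' ψ hψ y₀ x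
  set T : Matrix (Site d s) (Site d s) ℝ := Matrix.of fun yy y'' : Site d s =>
    (((n : ℝ) + 1) ^ d)⁻¹ * ∑ z : Fin d → Fin (n + 1), ψ y'' (siteOf d ((n + 1) * s) (chart n (windowMap d s yy) z)) with hT_def
  have hVl : ∀ x, -(-v₀) ≤ V x := fun x => by linarith [hV x]
  obtain ⟨hQ, hH, -⟩ := H137 n s V hVl hV' ψ hψ y₀
  -- `L_V h = T⁻¹(bt ·, y₀) − a·𝟙_{B_{y₀}}`
  have hLV : ∀ x' : Site d ((n + 1) * s),
      ((n : ℝ) + 1) ^ 2 * ∑ μ, (2 * (∑ y', T⁻¹ y' y₀ * ψ y' x') - (∑ y', T⁻¹ y' y₀ * ψ y' (x' + siteOf d ((n + 1) * s) (e μ)))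
          - (∑ y', T⁻¹ y' y₀ * ψ y' (x' - siteOf d ((n + 1) * s) (e μ))))
        + V x' * (∑ y', T⁻¹ y' y₀ * ψ y' x')
      = T⁻¹ (siteOf d s (blk n (windowMap d ((n + 1) * s) x'))) y₀
        - a * (if siteOf d s (blk n (windowMap d ((n + 1) * s) x')) = y₀ then 1 else 0) := by
    intro x'
    obtain ⟨⟨y, z⟩, hyz⟩ := siteOf_chart_surjective n s x'
    simp only at hyz
    have hblk : siteOf d s (blk n (windowMap d ((n + 1) * s) (siteOf d ((n + 1) * s) (chart n (windowMap d s y) z)))) = y :=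
      blockOf_siteOf_of_mem n s (mem_B.2 (blk_chart n (windowMap d s y) z))
    have hB : a / ((n : ℝ) + 1) ^ d * ∑ q ∈ B n (blk n (windowMap d ((n + 1) * s) x')), (∑ y', T⁻¹ y' y₀ * ψ y' (siteOf d ((n + 1) * s) q))
        = a * (if siteOf d s (blk n (windowMap d ((n + 1) * s) x')) = y₀ then 1 else 0) := by
      have hbt := sum_block_comp_siteOf_eq n s (fun x'' => ∑ y', T⁻¹ y' y₀ * ψ y' x'') (mem_B.2 (blk_chart n (windowMap d s y) z))
      beta_reduce at hbt
      rw [← hyz, hbt, sum_B, hblk, ← hQ y]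
      ring
    have h1 := hH x'
    rw [← hB]
    linarith
  -- the source letter `|G| ≤ (c₁ + a)e^{−δ₁ρ_s(bt ·, y₀)}`
  have hG : ∀ x' : Site d ((n + 1) * s),
      |T⁻¹ (siteOf d s (blk n (windowMap d ((n + 1) * s) x'))) y₀ - a * (if siteOf d s (blk n (windowMap d ((n + 1) * s) x')) = y₀ then 1 else 0)|
        ≤ (c₁ + a) * Real.exp (-(δ₁ * ∑ i, ((((siteOf d s (blk n (windowMap d ((n + 1) * s) x'))) i - y₀ i).valMinAbs.natAbs : ℕ) : ℝ))) := by
    intro x'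
    have h1 := H135 n s V hVl hV' ψ hψ (siteOf d s (blk n (windowMap d ((n + 1) * s) x'))) y₀
    have hE := Real.exp_pos (-(δ₁ * ∑ i, ((((siteOf d s (blk n (windowMap d ((n + 1) * s) x'))) i - y₀ i).valMinAbs.natAbs : ℕ) : ℝ)))
    refine (abs_sub _ _).trans ?_
    by_cases hx : siteOf d s (blk n (windowMap d ((n + 1) * s) x')) = y₀
    · rw [if_pos hx, mul_one, abs_of_pos ha]
      have h0 : ∑ i, ((((siteOf d s (blk n (windowMap d ((n + 1) * s) x'))) i - y₀ i).valMinAbs.natAbs : ℕ) : ℝ) = 0 := by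
        rw [hx]; exact (SupTorusBlockDistance.isPseudoDist_torus (d := d) s).zero y₀
      rw [h0] at h1 ⊢
      simp only [mul_zero, neg_zero, Real.exp_zero, mul_one] at h1 ⊢
      linarith
    · rw [if_neg hx, mul_zero, abs_zero, add_zero]
      exact h1.trans (by nlinarith [ha.le])
  have h := pointwise_decay n s hv₀ hδ0 hδ1 hδδ₁ hgap V hV y₀ (fun x' => ∑ y', T⁻¹ y' y₀ * ψ y' x')
    (fun x' => T⁻¹ (siteOf d s (blk n (windowMap d ((n + 1) * s) x'))) y₀
      - a * (if siteOf d s (blk n (windowMap d ((n + 1) * s) x')) = y₀ then 1 else 0)) hG hLV x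
  refine h.trans (mul_le_mul_of_nonneg_right ?_ (Real.exp_pos _).le)
  have he : Real.exp (2 * d * δ) ≤ Real.exp (2 * d) := Real.exp_le_exp.2 (by nlinarith)
  have : 0 ≤ 2 * (c₁ + a) * (4 : ℝ) ^ d := by positivity
  rw [div_le_div_iff_of_pos_right hv₀]
  nlinarith [mul_le_mul_of_nonneg_left he this]

/-! ## §5. Toy -/

/-- Toy (`d = 0`, `a = v₀ = Λ = 1`): the headline's hypotheses are inhabited, so the constants exist. -/
example : ∃ C δ : ℝ, 0 < C ∧ 0 < δ := let ⟨C, δ, hC, hδ, _⟩ := response_pointwise_decay (d := 0) 1 one_pos (v₀ := 1) one_pos zero_le_one; ⟨C, δ, hC, hδ⟩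


end Summit.QuantumFields.BalabanUV.T4Continuum.NE7b.SupTorusComparisonDecay
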